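import Literature.MathematicalPhysics.QuantumFieldTheory.Balaban1983to89.B6GOneLevelV1Bridge
import Literature.MathematicalPhysics.QuantumFieldTheory.Balaban1983to89.B5Prop12GHolds
import Literature.MathematicalPhysics.QuantumFieldTheory.Balaban1983to89.B5Cube1Partition
import Summits.QuantumFields.YangMills.Theorems.UnitScaleTiltProp7FlatCoercivityR
import HarnessLib

/-!
# Route `UnitScaleTilt`, crux K1 child «MinimiserStabilityRegPr» (stmt-QuantumFields-19200), leaves V2′ (one-step halving, Sect. F) and V3 (Prop. 7):
# **[Balaban1984PropagatorsI] PROPOSITION 1.2 AND (1.115)–(1.117) FOR THE FLAT CONSTRAINED VECTOR PROPAGATOR `G = Δ_a⁻¹` OF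
# [Balaban1984PropagatorsII] (2.19)/(2.90) AT EVERY PAIR `(P, j)` OF THE SETUP TORUS, ANY `a > 0` — by RE-INDEXING lit-balaban's
# hypothesis-free Prop. 1.2 on the torus family of record; the first (1.110)/(1.115) entries READ FOR THE V1 OPERATOR `GE`, the gradient and
# Laplacian entries for its torus transport; instances at the d = 3 carrier**

Cell `ym3-torus` (HUMAN RULING D-0037, YM ladder rung R3), seat `ym3-torus-p1` gen 14 (UV side); memo HOME/UV3-NODE.md §23.  `--supports
stmt-QuantumFields-19200 --as helper`.  Companion of `UnitScaleTiltProp8FlatPropagatorSup` (same seat; first entry at `a = 1` with b05's explicit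
`d`-only constants); THIS file reaches ALL of Prop. 1.2 and every `a > 0` at the price of constants that are functions of `(d, L, a)` chosen
before the volume, the run and the level (print: *«O(1) depending on d only»*; the `L`-dependence is harmless for the `∀ L`-stubs of 19200).

THE INPUT (kernel-checked, lit-balaban p37/p38): `B5Prop12GHolds.prop12_famG_printed : B5.Prop12Printed (famG d L a)` and
`global115_117_famG_printed : B5.Global115_117Fam (famG d L a) …` — Proposition 1.2 ((1.110)–(1.114): the four sup entries `|GJ|, |∇GJ|, |G∇*J|,
|ΔGJ| ≤ O(1)e^{−δ₀|y−y′|}|J|`, the Hölder entries, the six localized `L²` entries) and (1.115)–(1.117), HYPOTHESIS-FREE, for the concrete torus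
matrix `(B5DeltaA169.DeltaA n M a)⁻¹` on the family `famG d L a` of top-level tori `i ↦ latticeSettingP12R (L^{i.P.K}) (2L^{i.P.m}) a i.P.K`.
THE OBSERVATION of this file (§1): the member `i.P := ⟨P.d, P.L, P.m + P.K − j, j, …⟩` of that family has `nP i.P = P.L^j` and `MP i.P = Mk P j`
DEFINITIONALLY (`Setup.sitesPerDir j = 2L^{m+K−j}`), so Prop. 1.2 holds VERBATIM for b05's setting `latticeSettingP12R (P.L^j) (Mk P j) a j` at
EVERY `P : Params` and EVERY level `1 ≤ j` — the torus of the one-level two-scale structure `twoScale j hj1 ∅` of [Balaban1984PropagatorsII] (2.90)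
— with constants chosen before `P` (given `d = P.d`, `L = P.L`).  Then lit-balaban r03's one-level OPERATOR bridge `B6GOneLevelV1Bridge.TV_GE_twoScale_empty`
(`(G^{V1}x)~ = (Δ_a^{[B5]})⁻¹x̃`, weight `a·(L^j)^d` ↔ [B5] `a`) and p16's block dictionary (`B5Eq117TorusCarriers.EK_blockSiteK`/`blockEquivK`;
`B^j(y) ⊂ Δ̃(y)`: `EK_mem_cubeT`) read the entries for the V1 propagator `G = B6SectAVectorModelV1.GE` on the Setup torus `Site P 0`.
* §1 **`prop12_setup`**, **`global115_117_setup`** — `B5.Ineq110_114` / `B5.Global115_117` at `latticeSettingP12R (P.L^j) (Mk P j) a j`, every `P` with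
  `P.d = d`, `P.L = L`, every `1 ≤ j`, constants `δ₀, C, Cα, Cε, Cαε` before `P` and `j`.
* §2 `bpt_mem_cube1`, **`EK_mem_cubeT`** (`B^j(y) ⊂ Δ̃(y)`); **`abs_GE_le_of_ineq110`** — (1.110) first entry for `GE`: `x` real, `|x| ≤ B`, supported on
  the bonds issuing from `B^j(y′)`, `b₋ ∈ B^j(y)` ⇒ `|(Gx)(b)| ≤ C·e^{−δ₀|y−y′|}·B` (`|y−y′|` = `B5Prop12FieldsLattice.distSite`, the sup circular
  distance on `T^{(j)}`; `= torusSupNorm` of representatives by `B5Ineq110P12Lattice.distSite_eq_torusSupNorm`); **`grad_lap_TV_GE_le_of_ineq110`** —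
  the GRADIENT and LAPLACIAN entries of (1.110) for the torus transport `(Gx)~` (b05's `grad`, `Lap`), same right-hand side.
* §3 **`abs_GE_le_of_global115`** — (1.115) first entry for `GE`: `|(Gx)(b)| ≤ C·B`; **`exists_GE_sup_decay`** — PACKAGED for every `Params`:
  `∃ C δ₀ > 0` (functions of `d, L, a`) with (i) the global sup bound and (ii) the localized decay, for all `P` (`P.d = d`, `P.L = L`), `1 ≤ j`,
  `j + 1 ≤ m + K`, weights `a·(L^j)^d`.
* §4 **`exists_GE_sup_decay_T3`** — at the d = 3 carrier of `T3Thm1Carrier.varProblem3 F n K` (`F.L = L`, `n < K`, `j = K − n`, one more level by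
  `m ≥ 1` — `Prop7FlatCoercivityR.succ_le_T3`): the same two bounds, uniform in `m`, `n`, `K`.
HONEST SCOPE.  (i) The V1-side readings are the FIRST entries (values of `Gx`) plus the gradient/Laplacian entries in b05's torus letters for
`TV (Gx)`; the `G∇*J` entry, the Hölder entries (1.111)–(1.113), (1.116)–(1.117) and the `L²` entries (1.114) are available from §1 in b05's letters
and are not re-read here; (ii) `U = 1` (flat), ONE level (all `Ω_i = T_η`, `Λ′ = ∅`), print's residual-gauge `R` inside (2.19) (NOT the sharp-constraint
`H`/`G₁` of [Balaban1985Variational] (45)–(46)); (iii) constants are lit-balaban's (Combes–Thomas route for (1.114), the (1.132) transfer), functions of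
`(d, L, a)`, nothing printed is matched; (iv) `1 ≤ j` (the family of record has `1 ≤ K`).  No definition, no sorry, standard axioms.  NOT a claim
about the mass gap.

References: T. Bałaban, CMP **95** (1984) 17–40 [Balaban1984PropagatorsI] Prop. 1.2 (1.110)–(1.114) p.35–36, (1.115)–(1.117) p.36; CMP **96** (1984)
223–250 [Balaban1984PropagatorsII] (2.19)/(2.22) p.226, Prop. 2.2 p.234, (2.90) p.239; CMP **102** (1985) 277–309 [Balaban1985Variational] Sect. F
(162)–(164) p.302.
-/

set_option autoImplicit false

noncomputable section

open scoped BigOperators InnerProductSpace Matrix ComplexConjugate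

namespace Summit.QuantumFields.YangMills.Theorems.FlatPropagatorProp12

open Literature.MathematicalPhysics.QuantumFieldTheory.Balaban1983to89
open Literature.MathematicalPhysics.QuantumFieldTheory.BalabanImbrieJaffe1984to88.BIJ85AxialPropagator411 (BondSpace)
open LatticeFieldCalculus B6SectADomainsV1 B6SectAOperatorsV1 B6SectAVectorModelV1 B6SectCTwoScaleV1 B6GOneLevelV1Bridge
open B5Eq117TorusCarriers (Mk EK)
open B5Prop11Plancherel (Tor fine)
open B5DeltaA169 (DeltaA)
open B5SettingP12Real (LocR latticeSettingP12R gP12R)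
open B5Prop12FieldsLattice (distSite cube1 cubeT cubeB suppInL supNormL eL)
open B5Prop11Lattice (grad)
open B5Prop11Lower (Lap)
open LatticeNorms (supNorm norm_le_supNorm supNorm_le)
open B5Block118 (bpt)
open B5Blocks16 (bpt_val)
open B5Cube1Partition (mem_cube1_iff cube1_subset_cubeT)
open B5Eq117TorusCarriers (EK_blockSiteK blockSiteK blockEquivK)
open B5Eq118OneStroke (iterBlock)
open B5SiteBridgeP12 (nP MP)
open B5ResidualGpTorusHolds (TopIdx)
open B5Prop12GLattice (famG)
open B5Prop12GHolds (prop12_famG_printed global115_117_famG_printed)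

/-! ## §1 Proposition 1.2 and (1.115)–(1.117) for `G = Δ_a⁻¹` at the pair `(P, j)` -/

/-- **[Balaban1984PropagatorsI] PROPOSITION 1.2 AT THE PAIR `(P, j)`** — lit-balaban's hypothesis-free `prop12_famG_printed` re-indexed: for `d ≥ 1`,
odd `L > 1`, `a > 0` there are `δ₀ > 0`, `C > 0`, `Cα`, `Cε`, `Cαε` such that the typed block `B5.Ineq110_114` ((1.110)–(1.114)) holds for b05's real
setting `latticeSettingP12R (P.L^j) (Mk P j) a j` — the torus matrix `(Δ_a^{[B5]})⁻¹ = (DeltaA (L^j) (Mk P j) a)⁻¹` of the fine torus `Site P 0` with blocks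
`B^j` — for EVERY `P : Params` with `P.d = d`, `P.L = L` and EVERY `1 ≤ j` (the member `⟨P.d, P.L, P.m + P.K − j, j⟩` of the family of record,
definitionally). [cite: Balaban1984PropagatorsI, Prop. 1.2 (1.110)-(1.114) pp.35-36] -/
theorem prop12_setup (d L : ℕ) (hd : 1 ≤ d) (hL : Odd L ∧ 1 < L) {a : ℝ} (ha : 0 < a) :
    ∃ δ₀ C : ℝ, ∃ Cα Cε : ℝ → ℝ, ∃ Cαε : ℝ → ℝ → ℝ, 0 < δ₀ ∧ 0 < C ∧
      ∀ (P : Params), P.d = d → P.L = L → ∀ j : ℕ, 1 ≤ j →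
        B5.Ineq110_114 (latticeSettingP12R (P.L ^ j) (Mk P j) a j) C Cα Cε Cαε δ₀ := by
  obtain ⟨δ₀, C, Cα, Cε, Cαε, hδ, hC, h⟩ := prop12_famG_printed hd hL ha
  refine ⟨δ₀, C, Cα, Cε, Cαε, hδ, hC, fun P hPd hPL j hj => ?_⟩
  exact h ⟨⟨P.d, P.L, P.m + P.K - j, j, P.hd, P.hL⟩, hPd, hPL, hj⟩

/-- **[Balaban1984PropagatorsI] (1.115)–(1.117) AT THE PAIR `(P, j)`** — lit-balaban's `global115_117_famG_printed` re-indexed the same way (global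
cover `gP12R`). [cite: Balaban1984PropagatorsI, (1.115)-(1.117) p.36] -/
theorem global115_117_setup (d L : ℕ) (hd : 1 ≤ d) (hL : Odd L ∧ 1 < L) {a : ℝ} (ha : 0 < a) :
    ∃ C : ℝ, ∃ Cα Cε : ℝ → ℝ, ∃ Cαε : ℝ → ℝ → ℝ, 0 < C ∧
      ∀ (P : Params), P.d = d → P.L = L → ∀ j : ℕ, 1 ≤ j →
        B5.Global115_117 (latticeSettingP12R (P.L ^ j) (Mk P j) a j) (gP12R (Mk P j) (P.L ^ j) a j) C Cα Cε Cαε := by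
  obtain ⟨C, Cα, Cε, Cαε, hC, h⟩ := global115_117_famG_printed hd hL ha
  refine ⟨C, Cα, Cε, Cαε, hC, fun P hPd hPL j hj => ?_⟩
  exact h ⟨⟨P.d, P.L, P.m + P.K - j, j, P.hd, P.hL⟩, hPd, hPL, hj⟩

/-! ## §2 The first entry of (1.110) at general `a`, read for the V1 propagator `G = GE` -/

/-- Every site of `B^j(y)` is a block point `bpt y r` under `EK` (p16's `blockEquivK`, `EK_blockSiteK`).
[cite: Balaban1984PropagatorsI, (1.6) p.18, (1.18) p.20] -/
private theorem exists_EK_eq_bpt' {P : Params} {j : ℕ} (hj : j ≤ P.m + P.K) {y : Site P j} {x : Site P 0}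
    (hx : x ∈ iterBlock j y) : ∃ r : Fin P.d → Fin (P.L ^ j), EK hj x = bpt (P.L ^ j) (Mk P j) y r := by
  refine ⟨(blockEquivK hj y).symm ⟨x, hx⟩, ?_⟩
  have h : blockSiteK j y ((blockEquivK hj y).symm ⟨x, hx⟩) = x :=
    congrArg Subtype.val ((blockEquivK hj y).apply_symm_apply ⟨x, hx⟩)
  rw [← EK_blockSiteK hj, h]

/-- A block point `bpt y r` lies in b05's unit cube `Δ(y) = cube1 y`. [cite: Balaban1984PropagatorsI, p.35 (Δ(y) = B^k(y))] -/
theorem bpt_mem_cube1 {d : ℕ} (n : ℕ) [NeZero n] (M : Fin d → ℕ) [∀ μ, NeZero (M μ)] (hn : 1 ≤ n)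
    (y : Tor M) (r : Fin d → Fin n) : bpt n M y r ∈ cube1 n M y := by
  rw [mem_cube1_iff]
  funext μ
  show (((bpt n M y r μ).val / n : ℕ) : ZMod (M μ)) = y μ
  rw [bpt_val, Nat.mul_add_div (by omega), Nat.div_eq_of_lt (r μ).isLt, add_zero, ZMod.natCast_zmod_val]

/-- **`B^j(y) ⊂ Δ̃(y)`** in b05's letters: a site of Bałaban's block over `y` is taken by `EK` into the size-2 cube `cubeT` centred at `n·y`.
[cite: Balaban1984PropagatorsI, p.35 («Cubes Δ̃(y) are sums of 2^d unit cubes having the point y as a corner»)] -/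
theorem EK_mem_cubeT {P : Params} {j : ℕ} (hj : j ≤ P.m + P.K) {y : Site P j} {x : Site P 0} (hx : x ∈ iterBlock j y) :
    EK hj x ∈ cubeT (P.L ^ j) (Mk P j) y := by
  obtain ⟨r, hr⟩ := exists_EK_eq_bpt' hj hx
  rw [hr]
  have hn : 1 ≤ P.L ^ j := Nat.one_le_pow _ _ P.L_pos
  exact cube1_subset_cubeT (Mk P j) (P.L ^ j) hn y (bpt_mem_cube1 (P.L ^ j) (Mk P j) hn y r)

/-- **THE FIRST ENTRY OF (1.110) FOR THE V1 PROPAGATOR AT GENERAL `a`** — from the typed Prop. 1.2 block `B5.Ineq110_114` of b05's real setting at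
`(n, M) = (L^j, Mk P j)`: for the one-level structure `twoScale j hj1 ∅` with lattice factor `L^j` and weight `a·(L^j)^d`, a real bond field `x`
with `|x| ≤ B` supported on the bonds issuing from `B^j(y′)`, and a bond `b` issuing from `B^j(y)`:
`|(Gx)(b)| ≤ C·e^{−δ₀|y−y′|}·B`, `|y − y′| = distSite` (sup circular distance on `T^{(j)}`). [cite: Balaban1984PropagatorsI, Prop. 1.2 (1.110) p.35; Balaban1984PropagatorsII, (2.22) p.226] -/
theorem abs_GE_le_of_ineq110 {P : Params} {j : ℕ} (hj1 : j + 1 ≤ P.m + P.K) {a : ℝ} (ha : 0 < a)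
    {C δ₀ : ℝ} (hC : 0 ≤ C) {Cα Cε : ℝ → ℝ} {Cαε : ℝ → ℝ → ℝ}
    (hI : B5.Ineq110_114 (latticeSettingP12R (P.L ^ j) (Mk P j) a j) C Cα Cε Cαε δ₀)
    {w : BondIdx (twoScale j hj1 (∅ : Finset (Site P (j + 1)))) → ℝ}
    (hw : ∀ i, 0 < w i) (hwa : ∀ p, w p = a * ((P.L : ℝ) ^ j) ^ P.d) (x : BondSpace P) {B : ℝ} (hxB : ∀ b', |x b'| ≤ B)
    (y y' : Site P j) (hsupp : ∀ b', x b' ≠ 0 → b'.src ∈ iterBlock j y')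
    (b : PBond P 0) (hb : b.src ∈ iterBlock j y) :
    |GE (twoScale j hj1 ∅) (c := (P.L : ℝ) ^ j) (pow_ne_zero j (Nat.cast_ne_zero.2 P.L_pos.ne')) hw x b|
      ≤ C * Real.exp (-(δ₀ * distSite (Mk P j) y y')) * B := by
  have hj : j ≤ P.m + P.K := Nat.le_of_succ_le hj1
  have hB : 0 ≤ B := (abs_nonneg _).trans (hxB b)
  -- the real source `J̃ = x̃` on the torus of record and its embedding `TV x`
  set Jr : Tor (fine (P.L ^ j) (Mk P j)) × Fin P.d → ℝ := fun i => x ⟨(EK hj).symm i.1, i.2⟩ with hJr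
  have hemb : (LocR.vec Jr).emb = .vec (TV hj x) := by
    rw [TV_eq_cplx]
    rfl
  -- the (1.110) first entry of the setting at `n = 0`
  have h110 := hI.1 0 (LocR.vec Jr) y y' (by
    show suppInL (P.L ^ j) (Mk P j) (LocR.vec Jr).emb y'
    rw [hemb]
    rintro ⟨z, μ⟩ hz
    rw [TV_apply, Ne, Complex.ofReal_eq_zero] at hz
    have hmem := hsupp ⟨(EK hj).symm z, μ⟩ hz
    have := EK_mem_cubeT hj hmem
    rwa [Equiv.apply_symm_apply] at this)
  -- unfold the entry and the sup norm of the source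
  have hsup : (latticeSettingP12R (P.L ^ j) (Mk P j) a j).supNorm (LocR.vec Jr) ≤ B := by
    show supNormL (P.L ^ j) (Mk P j) (LocR.vec Jr).emb ≤ B
    rw [hemb]
    show supNorm Finset.univ (TV hj x) ≤ B
    refine supNorm_le hB fun i _ => ?_
    obtain ⟨z, μ⟩ := i
    rw [TV_apply, Complex.norm_real, Real.norm_eq_abs]
    exact hxB _
  have he : (latticeSettingP12R (P.L ^ j) (Mk P j) a j).e 0 (LocR.vec Jr) y
      = supNorm (cubeB (P.L ^ j) (Mk P j) y) ((DeltaA (P.L ^ j) (Mk P j) a)⁻¹ *ᵥ TV hj x) := by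
    show eL (P.L ^ j) (Mk P j) a 0 (LocR.vec Jr).emb y = _
    rw [hemb]
    rfl
  rw [he] at h110
  -- the value of `G x` at `b` is an entry of `(Δ_a)⁻¹ x̃` inside the cube `Δ̃(y)`
  have hval : ((GE (twoScale j hj1 ∅) (c := (P.L : ℝ) ^ j) (pow_ne_zero j (Nat.cast_ne_zero.2 P.L_pos.ne')) hw x b : ℝ) : ℂ)
      = ((DeltaA (P.L ^ j) (Mk P j) a)⁻¹ *ᵥ TV hj x) (EK hj b.src, b.dir) := by
    rw [← TV_apply_EK hj, TV_GE_twoScale_empty hj1 hw ha hwa x]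
  have hmemB : (EK hj b.src, b.dir) ∈ cubeB (P.L ^ j) (Mk P j) y :=
    Finset.mem_product.2 ⟨EK_mem_cubeT hj hb, Finset.mem_univ _⟩
  have h1 : |GE (twoScale j hj1 ∅) (c := (P.L : ℝ) ^ j) (pow_ne_zero j (Nat.cast_ne_zero.2 P.L_pos.ne')) hw x b|
      ≤ supNorm (cubeB (P.L ^ j) (Mk P j) y) ((DeltaA (P.L ^ j) (Mk P j) a)⁻¹ *ᵥ TV hj x) := by
    rw [← Real.norm_eq_abs, ← Complex.norm_real, hval]
    exact norm_le_supNorm _ hmemB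
  refine h1.trans (h110.trans ?_)
  exact mul_le_mul_of_nonneg_left hsup (mul_nonneg hC (Real.exp_pos _).le)

/-- **THE GRADIENT AND LAPLACIAN ENTRIES OF (1.110) FOR THE TRANSPORTED `Gx`** (b05's torus letters: `∇_ν` = `B5Prop11Lattice.grad`, the
`η`-scaled forward differences; `Δ` = `B5Prop11Lower.Lap`): under the same hypotheses, the sup over `ν` and over the bonds of `Δ̃(y)` of
`|∇_ν (Gx)~|` and the sup over the bonds of `Δ̃(y)` of `|Δ(Gx)~|` are `≤ C·e^{−δ₀|y−y′|}·B`, where `(Gx)~ = TV (Gx) = (Δ_a^{[B5]})⁻¹x̃`.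
[cite: Balaban1984PropagatorsI, Prop. 1.2 (1.110) p.35; Balaban1984PropagatorsII, (2.22) p.226] -/
theorem grad_lap_TV_GE_le_of_ineq110 {P : Params} {j : ℕ} (hj1 : j + 1 ≤ P.m + P.K) {a : ℝ} (ha : 0 < a)
    {C δ₀ : ℝ} (hC : 0 ≤ C) {Cα Cε : ℝ → ℝ} {Cαε : ℝ → ℝ → ℝ}
    (hI : B5.Ineq110_114 (latticeSettingP12R (P.L ^ j) (Mk P j) a j) C Cα Cε Cαε δ₀)
    {w : BondIdx (twoScale j hj1 (∅ : Finset (Site P (j + 1)))) → ℝ}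
    (hw : ∀ i, 0 < w i) (hwa : ∀ p, w p = a * ((P.L : ℝ) ^ j) ^ P.d) (x : BondSpace P) {B : ℝ} (hxB : ∀ b', |x b'| ≤ B)
    (y y' : Site P j) (hsupp : ∀ b', x b' ≠ 0 → b'.src ∈ iterBlock j y') :
    supNorm (Finset.univ ×ˢ cubeB (P.L ^ j) (Mk P j) y)
        (fun p : Fin P.d × (Tor (fine (P.L ^ j) (Mk P j)) × Fin P.d) =>
          grad (P.L ^ j) (Mk P j) (TV (Nat.le_of_succ_le hj1)
            (GE (twoScale j hj1 ∅) (c := (P.L : ℝ) ^ j) (pow_ne_zero j (Nat.cast_ne_zero.2 P.L_pos.ne')) hw x)) p.1 p.2)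
      ≤ C * Real.exp (-(δ₀ * distSite (Mk P j) y y')) * B ∧
    supNorm (cubeB (P.L ^ j) (Mk P j) y)
        (Lap (P.L ^ j) (Mk P j) *ᵥ TV (Nat.le_of_succ_le hj1)
          (GE (twoScale j hj1 ∅) (c := (P.L : ℝ) ^ j) (pow_ne_zero j (Nat.cast_ne_zero.2 P.L_pos.ne')) hw x))
      ≤ C * Real.exp (-(δ₀ * distSite (Mk P j) y y')) * B := by
  have hj : j ≤ P.m + P.K := Nat.le_of_succ_le hj1
  have hB : 0 ≤ B := by
    obtain ⟨b⟩ : Nonempty (PBond P 0) := ⟨⟨fun _ => 0, ⟨0, P.hd⟩⟩⟩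
    exact (abs_nonneg _).trans (hxB b)
  set Jr : Tor (fine (P.L ^ j) (Mk P j)) × Fin P.d → ℝ := fun i => x ⟨(EK hj).symm i.1, i.2⟩ with hJr
  have hemb : (LocR.vec Jr).emb = .vec (TV hj x) := by
    rw [TV_eq_cplx]
    rfl
  have hsuppJ : (latticeSettingP12R (P.L ^ j) (Mk P j) a j).suppIn (LocR.vec Jr) y' := by
    show suppInL (P.L ^ j) (Mk P j) (LocR.vec Jr).emb y'
    rw [hemb]
    rintro ⟨z, μ⟩ hz
    rw [TV_apply, Ne, Complex.ofReal_eq_zero] at hz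
    have hmem := hsupp ⟨(EK hj).symm z, μ⟩ hz
    have := EK_mem_cubeT hj hmem
    rwa [Equiv.apply_symm_apply] at this
  have hsup : (latticeSettingP12R (P.L ^ j) (Mk P j) a j).supNorm (LocR.vec Jr) ≤ B := by
    show supNormL (P.L ^ j) (Mk P j) (LocR.vec Jr).emb ≤ B
    rw [hemb]
    show supNorm Finset.univ (TV hj x) ≤ B
    refine supNorm_le hB fun i _ => ?_
    obtain ⟨z, μ⟩ := i
    rw [TV_apply, Complex.norm_real, Real.norm_eq_abs]
    exact hxB _
  have hrhs : C * Real.exp (-(δ₀ * distSite (Mk P j) y y')) * (latticeSettingP12R (P.L ^ j) (Mk P j) a j).supNorm (LocR.vec Jr)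
      ≤ C * Real.exp (-(δ₀ * distSite (Mk P j) y y')) * B :=
    mul_le_mul_of_nonneg_left hsup (mul_nonneg hC (Real.exp_pos _).le)
  rw [TV_GE_twoScale_empty hj1 hw ha hwa x]
  constructor
  · have h := hI.1 1 (LocR.vec Jr) y y' hsuppJ
    have he : (latticeSettingP12R (P.L ^ j) (Mk P j) a j).e 1 (LocR.vec Jr) y
        = supNorm (Finset.univ ×ˢ cubeB (P.L ^ j) (Mk P j) y)
            (fun p : Fin P.d × (Tor (fine (P.L ^ j) (Mk P j)) × Fin P.d) =>
              grad (P.L ^ j) (Mk P j) ((DeltaA (P.L ^ j) (Mk P j) a)⁻¹ *ᵥ TV hj x) p.1 p.2) := by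
      show eL (P.L ^ j) (Mk P j) a 1 (LocR.vec Jr).emb y = _
      rw [hemb]
      rfl
    rw [he] at h
    exact h.trans hrhs
  · have h := hI.1 3 (LocR.vec Jr) y y' hsuppJ
    have he : (latticeSettingP12R (P.L ^ j) (Mk P j) a j).e 3 (LocR.vec Jr) y
        = supNorm (cubeB (P.L ^ j) (Mk P j) y) (Lap (P.L ^ j) (Mk P j) *ᵥ ((DeltaA (P.L ^ j) (Mk P j) a)⁻¹ *ᵥ TV hj x)) := by
      show eL (P.L ^ j) (Mk P j) a 3 (LocR.vec Jr).emb y = _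
      rw [hemb]
      rfl
    rw [he] at h
    exact h.trans hrhs

/-! ## §3 The global sup entry (1.115) at general `a`, and the packaged statements -/

/-- **THE FIRST ENTRY OF (1.115) FOR THE V1 PROPAGATOR AT GENERAL `a`** — from the typed block `B5.Global115_117`: `|(Gx)(b)| ≤ C·B` for every real
bond field with `|x| ≤ B` and every bond. [cite: Balaban1984PropagatorsI, (1.115) p.36; Balaban1984PropagatorsII, (2.22) p.226] -/
theorem abs_GE_le_of_global115 {P : Params} {j : ℕ} (hj1 : j + 1 ≤ P.m + P.K) {a : ℝ} (ha : 0 < a)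
    {C : ℝ} (hC : 0 ≤ C) {Cα Cε : ℝ → ℝ} {Cαε : ℝ → ℝ → ℝ}
    (hG : B5.Global115_117 (latticeSettingP12R (P.L ^ j) (Mk P j) a j) (gP12R (Mk P j) (P.L ^ j) a j) C Cα Cε Cαε)
    {w : BondIdx (twoScale j hj1 (∅ : Finset (Site P (j + 1)))) → ℝ}
    (hw : ∀ i, 0 < w i) (hwa : ∀ p, w p = a * ((P.L : ℝ) ^ j) ^ P.d) (x : BondSpace P) {B : ℝ} (hxB : ∀ b', |x b'| ≤ B)
    (b : PBond P 0) :
    |GE (twoScale j hj1 ∅) (c := (P.L : ℝ) ^ j) (pow_ne_zero j (Nat.cast_ne_zero.2 P.L_pos.ne')) hw x b| ≤ C * B := by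
  have hj : j ≤ P.m + P.K := Nat.le_of_succ_le hj1
  have hB : 0 ≤ B := (abs_nonneg _).trans (hxB b)
  set Jr : Tor (fine (P.L ^ j) (Mk P j)) × Fin P.d → ℝ := fun i => x ⟨(EK hj).symm i.1, i.2⟩ with hJr
  have hemb : (LocR.vec Jr).emb = .vec (TV hj x) := by
    rw [TV_eq_cplx]
    rfl
  set y : Site P j := B5Eq118OneStroke.iterBlockOf j b.src with hy
  have hb : b.src ∈ iterBlock j y := (B5Eq118OneStroke.mem_iterBlock j y b.src).2 rfl
  have h115 := hG.1 0 (LocR.vec Jr) y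
  have hsup : (latticeSettingP12R (P.L ^ j) (Mk P j) a j).supNorm (LocR.vec Jr) ≤ B := by
    show supNormL (P.L ^ j) (Mk P j) (LocR.vec Jr).emb ≤ B
    rw [hemb]
    show supNorm Finset.univ (TV hj x) ≤ B
    refine supNorm_le hB fun i _ => ?_
    obtain ⟨z, μ⟩ := i
    rw [TV_apply, Complex.norm_real, Real.norm_eq_abs]
    exact hxB _
  have he : (latticeSettingP12R (P.L ^ j) (Mk P j) a j).e 0 (LocR.vec Jr) y
      = supNorm (cubeB (P.L ^ j) (Mk P j) y) ((DeltaA (P.L ^ j) (Mk P j) a)⁻¹ *ᵥ TV hj x) := by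
    show eL (P.L ^ j) (Mk P j) a 0 (LocR.vec Jr).emb y = _
    rw [hemb]
    rfl
  rw [he] at h115
  have hval : ((GE (twoScale j hj1 ∅) (c := (P.L : ℝ) ^ j) (pow_ne_zero j (Nat.cast_ne_zero.2 P.L_pos.ne')) hw x b : ℝ) : ℂ)
      = ((DeltaA (P.L ^ j) (Mk P j) a)⁻¹ *ᵥ TV hj x) (EK hj b.src, b.dir) := by
    rw [← TV_apply_EK hj, TV_GE_twoScale_empty hj1 hw ha hwa x]
  have hmemB : (EK hj b.src, b.dir) ∈ cubeB (P.L ^ j) (Mk P j) y :=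
    Finset.mem_product.2 ⟨EK_mem_cubeT hj hb, Finset.mem_univ _⟩
  have h1 : |GE (twoScale j hj1 ∅) (c := (P.L : ℝ) ^ j) (pow_ne_zero j (Nat.cast_ne_zero.2 P.L_pos.ne')) hw x b|
      ≤ supNorm (cubeB (P.L ^ j) (Mk P j) y) ((DeltaA (P.L ^ j) (Mk P j) a)⁻¹ *ᵥ TV hj x) := by
    rw [← Real.norm_eq_abs, ← Complex.norm_real, hval]
    exact norm_le_supNorm _ hmemB
  exact h1.trans (h115.trans (mul_le_mul_of_nonneg_left hsup hC))

/-- **PACKAGED, EVERY `Params`**: for fixed `d ≥ 1`, odd `L > 1`, `a > 0` there are `C, δ₀ > 0` (functions of `d, L, a`) such that for every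
`P` with `P.d = d`, `P.L = L` (any volume `m`, any run `K`), every level `1 ≤ j`, `j + 1 ≤ m + K`, the V1 propagator `G` of the one-level
structure with lattice factor `L^j` and weight `a·(L^j)^d` satisfies, for every real bond field with `|x| ≤ B`: (i) `|(Gx)(b)| ≤ C·B` everywhere;
(ii) if `x` is supported on the bonds issuing from `B^j(y′)`, then `|(Gx)(b)| ≤ C·e^{−δ₀|y−y′|}·B` at every bond issuing from `B^j(y)` —
[Balaban1984PropagatorsI] (1.115)/(1.110), first entries, for `G = Δ_a⁻¹` of [Balaban1984PropagatorsII] (2.19), from lit-balaban's hypothesis-free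
Prop. 1.2 `B5Prop12GHolds.prop12_famG_printed` / `global115_117_famG_printed`. [cite: Balaban1984PropagatorsI, Prop. 1.2 (1.110) p.35, (1.115) p.36] -/
theorem exists_GE_sup_decay (d L : ℕ) (hd : 1 ≤ d) (hL : Odd L ∧ 1 < L) {a : ℝ} (ha : 0 < a) :
    ∃ C δ₀ : ℝ, 0 < C ∧ 0 < δ₀ ∧ ∀ (P : Params), P.d = d → P.L = L → ∀ (j : ℕ), 1 ≤ j → ∀ (hj1 : j + 1 ≤ P.m + P.K)
      (w : BondIdx (twoScale j hj1 (∅ : Finset (Site P (j + 1)))) → ℝ) (hw : ∀ i, 0 < w i),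
      (∀ p, w p = a * ((P.L : ℝ) ^ j) ^ P.d) → ∀ (x : BondSpace P) (B : ℝ), (∀ b', |x b'| ≤ B) →
        (∀ b : PBond P 0,
          |GE (twoScale j hj1 ∅) (c := (P.L : ℝ) ^ j) (pow_ne_zero j (Nat.cast_ne_zero.2 P.L_pos.ne')) hw x b| ≤ C * B) ∧
        (∀ (y y' : Site P j), (∀ b', x b' ≠ 0 → b'.src ∈ iterBlock j y') → ∀ b : PBond P 0, b.src ∈ iterBlock j y →
          |GE (twoScale j hj1 ∅) (c := (P.L : ℝ) ^ j) (pow_ne_zero j (Nat.cast_ne_zero.2 P.L_pos.ne')) hw x b|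
            ≤ C * Real.exp (-(δ₀ * distSite (Mk P j) y y')) * B) := by
  obtain ⟨δ₀, C₁, Cα, Cε, Cαε, hδ, hC₁, h110⟩ := prop12_setup d L hd hL ha
  obtain ⟨C₂, Cα', Cε', Cαε', hC₂, h115⟩ := global115_117_setup d L hd hL ha
  refine ⟨max C₁ C₂, δ₀, lt_max_of_lt_left hC₁, hδ, fun P hPd hPL j hj hj1 w hw hwa x B hxB => ⟨fun b => ?_, fun y y' hsupp b hb => ?_⟩⟩
  · have hB : 0 ≤ B := (abs_nonneg _).trans (hxB b)
    exact (abs_GE_le_of_global115 hj1 ha hC₂.le (h115 P hPd hPL j hj) hw hwa x hxB b).trans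
      (mul_le_mul_of_nonneg_right (le_max_right _ _) hB)
  · have hB : 0 ≤ B := (abs_nonneg _).trans (hxB b)
    exact (abs_GE_le_of_ineq110 hj1 ha hC₁.le (h110 P hPd hPL j hj) hw hwa x hxB y y' hsupp b hb).trans
      (mul_le_mul_of_nonneg_right (mul_le_mul_of_nonneg_right (le_max_left _ _) (Real.exp_pos _).le) hB)

/-! ## §4 At the d = 3 carrier (fine torus `Site (F.P K) 0`, level `j = K − n`, any weight `a > 0`) -/

section T3

open T3ContinuumYM3Torus (T3Family)
open Prop7FlatCoercivityR (succ_le_T3)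

/-- **[Balaban1984PropagatorsI] (1.115)/(1.110), FIRST ENTRIES, AT THE d = 3 CARRIER, ANY `a > 0`**: for each odd `L > 1` and `a > 0` there are
`C, δ₀ > 0` such that for every member `F` of the T³ family with `F.L = L`, all heights `n < K`, the one-level V1 propagator `G` at `j = K − n`
with weight `a·(L^{K−n})³` satisfies (i) `|(Gx)(b)| ≤ C·B` and (ii) the localized decay `|(Gx)(b)| ≤ C·e^{−δ₀|y−y′|}·B` (`x` supported on the bonds
from `B^{K−n}(y′)`, `b₋ ∈ B^{K−n}(y)`, `|y−y′|` = `distSite` on `T^{(K−n)}`) — uniform in `m`, `n`, `K`.  The flat input of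
[Balaban1985Variational] Sect. F (162)–(164) at `U₀ = 1` for its first entry. [cite: Balaban1984PropagatorsI, (1.110) p.35, (1.115) p.36; Balaban1985Variational, Sect. F (162)-(164) p.302] -/
theorem exists_GE_sup_decay_T3 (L : ℕ) (hL : Odd L ∧ 1 < L) {a : ℝ} (ha : 0 < a) :
    ∃ C δ₀ : ℝ, 0 < C ∧ 0 < δ₀ ∧ ∀ (F : T3Family), F.L = L → ∀ (n K : ℕ), n < K →
      ∀ (w : BondIdx (twoScale (K - n) (succ_le_T3 F n K) (∅ : Finset (Site (F.P K) (K - n + 1)))) → ℝ) (hw : ∀ i, 0 < w i),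
      (∀ p, w p = a * ((F.L : ℝ) ^ (K - n)) ^ 3) → ∀ (x : BondSpace (F.P K)) (B : ℝ), (∀ b', |x b'| ≤ B) →
        (∀ b : PBond (F.P K) 0,
          |GE (twoScale (K - n) (succ_le_T3 F n K) ∅) (c := ((F.L : ℝ)) ^ (K - n))
            (pow_ne_zero (K - n) (Nat.cast_ne_zero.2 (F.P K).L_pos.ne')) hw x b| ≤ C * B) ∧
        (∀ (y y' : Site (F.P K) (K - n)), (∀ b', x b' ≠ 0 → b'.src ∈ iterBlock (K - n) y') →
          ∀ b : PBond (F.P K) 0, b.src ∈ iterBlock (K - n) y →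
            |GE (twoScale (K - n) (succ_le_T3 F n K) ∅) (c := ((F.L : ℝ)) ^ (K - n))
                (pow_ne_zero (K - n) (Nat.cast_ne_zero.2 (F.P K).L_pos.ne')) hw x b|
              ≤ C * Real.exp (-(δ₀ * distSite (Mk (F.P K) (K - n)) y y')) * B) := by
  obtain ⟨C, δ₀, hC, hδ, h⟩ := exists_GE_sup_decay 3 L (by norm_num) hL ha
  refine ⟨C, δ₀, hC, hδ, fun F hFL n K hnK w hw hwa x B hxB => ?_⟩
  exact h (F.P K) rfl hFL (K - n) (by omega) (succ_le_T3 F n K) w hw hwa x B hxB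

end T3

end Summit.QuantumFields.YangMills.Theorems.FlatPropagatorProp12

end
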